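import Mathlib.Algebra.MvPolynomial.Basic
import Mathlib.Data.Nat.Log
import Mathlib.Data.Nat.Factorial.Basic
import Mathlib.GroupTheory.Perm.Basic
import Mathlib.Data.Fintype.Perm
import Mathlib.Data.Fintype.Sum
import Mathlib.Data.Fintype.Prod
import Mathlib.LinearAlgebra.Matrix.Determinant.Basic
import Mathlib.LinearAlgebra.Matrix.Permanent
import Mathlib.Data.Complex.Basic
import Mathlib.Tactic.Linarith
import Literature.Computability.AlgebraicComplexity.StandardFamilies

/-!
# Crux `MonotoneCoverHard` (stmt-ValiantsHypothesis-7421), line `few-state-cut`: CALIBRATION of the bet —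
`stub_fewStateCut` is a weakly-exponential size lower bound for Pfaffian covers in disguise

Helper / calibration file (val-width-7421-p2 g0, 2026-08-27).  Write `Cover(n, m, E, a)` for the three
hypotheses shared by the two stubs of `Cruxes/MonotoneCoverHard/Lines/few_state_cut.lean` (a Pfaffian
signing of `E`; labels in `{X j, 0, 1}`; `per_n = aeval a PM_E`), `Bal(S)` for the balance clause of a
vertex set `S ⊆ Fin m ⊕ Fin m` (every weight-nonzero perfect matching has between `n/3` and `2n/3`
variable edges inside `S`) and `N(S)` for its number of crossing states.  The (repaired) bet is
`BET : ∃ c n₀, ∀ n ≥ n₀, ∀ Cover, ∃ S, Bal(S) ∧ N(S) ≤ 2^((log₂ m + c)^c)`.  Consider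

* `WEAKEXP : ∃ d n₁, ∀ n ≥ n₁, ∀ Cover, n ≤ (log₂ m + d)^d` — every label-bijective Pfaffian cover of
  `per_n` has size `m ≥ 2^(n^(1/d) - d)`; this implies the crux `MonotoneCoverHard` outright (polylog vs.
  linear — exactly the arithmetic of the skeleton's `MonotoneCoverHard_of`);
* `BALEX : ∃ n₂, ∀ n ≥ n₂, ∀ Cover, ∃ S, Bal(S)` — a balanced vertex set exists at all;
* `COUNT : ∀ Cover, #{weight-nonzero perfect matchings} ≤ n!` — label-injectivity, a consequence of the
  identity `per_n = aeval a PM_E` (coefficients of `per_n` are `≤ 1`); landed separately by the seat on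
  `stub_rectangleBound`, taken here as a hypothesis;
* `RECT` = the registered stub `stub_rectangleBound` (`Bal(S) → 2^(n/3) ≤ N(S)`), taken as a hypothesis.

Theorems (pure arithmetic on top of the verbatim statements; no definitions):

* `weakExp_of_bet_of_rect` — `BET ∧ RECT ⇒ WEAKEXP` (with `d = c + 3`);
* `balEx_of_bet` — `BET ⇒ BALEX`;
* `bet_of_weakExp_of_balEx_of_count` — `WEAKEXP ∧ BALEX ∧ COUNT ⇒ BET` (with `c = 2d + 1`): given a size
  lower bound, ANY balanced vertex set has few states, because `N(S) ≤ n! ≤ 2^(n·n)`-type counting is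
  already quasi-polynomial in `m` once `n ≤ polylog m`.

READING.  Modulo the provable `RECT` and the true `COUNT`, the line's load-bearing stub is EQUIVALENT to
`WEAKEXP ∧ BALEX`: a weakly-exponential lower bound for label-bijective Pfaffian covers (strictly
stronger than the crux, which only asks for super-quasi-polynomial) plus a side condition.  The cut /
state language of the line is therefore a mechanism pointer (thin balanced cuts from Pfaffian structure),
not a logical reduction of the crux.  VP ≠ VNP is not moved by this file.
-/

namespace Summit.ValiantsHypothesis.ValiantsHypothesis.Theorems.PolyaContinuedMonotoneCoverHard

-- summit = sub-problem name (single-conjunct summit, D-0017 layout), so the namespace repeats it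
set_option linter.dupNamespace false

open scoped Classical
open Finset

/-- Arithmetic: `3 X + 2 ≤ (L + c + 3)^(c + 3)` for `X = (L + c)^c`. -/
theorem three_mul_pow_add_two_le (L c : ℕ) :
    3 * (L + c) ^ c + 2 ≤ (L + (c + 3)) ^ (c + 3) := by
  have hX : 1 ≤ (L + c) ^ c := by
    rcases Nat.eq_zero_or_pos c with hc | hc
    · subst hc; simp
    · exact Nat.one_le_pow _ _ (by omega)
  have h1 : (L + c) ^ c ≤ (L + (c + 3)) ^ c := Nat.pow_le_pow_left (by omega) c
  have h2 : 27 ≤ (L + (c + 3)) ^ 3 := by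
    calc 27 = 3 ^ 3 := by norm_num
      _ ≤ (L + (c + 3)) ^ 3 := Nat.pow_le_pow_left (by omega) 3
  calc 3 * (L + c) ^ c + 2 ≤ (L + c) ^ c * 27 := by omega
    _ ≤ (L + (c + 3)) ^ c * (L + (c + 3)) ^ 3 := Nat.mul_le_mul h1 h2
    _ = (L + (c + 3)) ^ (c + 3) := (pow_add _ _ _).symm

/-- Arithmetic: if `n ≤ X` then `n ! ≤ 2 ^ (X * X)`. -/
theorem factorial_le_two_pow_mul_self {n X : ℕ} (h : n ≤ X) : n.factorial ≤ 2 ^ (X * X) := by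
  rcases Nat.eq_zero_or_pos n with hn | hn
  · subst hn; simpa using Nat.one_le_two_pow
  have hX : 1 ≤ X := by omega
  calc n.factorial ≤ n ^ n := Nat.factorial_le_pow n
    _ ≤ X ^ n := Nat.pow_le_pow_left h n
    _ ≤ X ^ X := Nat.pow_le_pow_right hX h
    _ ≤ (2 ^ X) ^ X := Nat.pow_le_pow_left (Nat.lt_two_pow_self).le X
    _ = 2 ^ (X * X) := by rw [← pow_mul]

/-- Arithmetic: `(L + d)^d * (L + d)^d ≤ (L + (2 d + 1))^(2 d + 1)`. -/
theorem pow_mul_pow_le (L d : ℕ) :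
    (L + d) ^ d * (L + d) ^ d ≤ (L + (2 * d + 1)) ^ (2 * d + 1) := by
  calc (L + d) ^ d * (L + d) ^ d = (L + d) ^ (2 * d) := by rw [← pow_add]; ring_nf
    _ ≤ (L + (2 * d + 1)) ^ (2 * d) := Nat.pow_le_pow_left (by omega) _
    _ ≤ (L + (2 * d + 1)) ^ (2 * d + 1) := Nat.pow_le_pow_right (by omega) (by omega)

/-- **`BET ∧ RECT ⇒ WEAKEXP`.**  If the (repaired) bet `stub_fewStateCut` holds with exponent `c` and
threshold `n₀`, and the rectangle stub `stub_rectangleBound` holds, then every label-bijective Pfaffian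
cover of `per_n`, `n ≥ n₀`, on `m + m` vertices satisfies `n ≤ (log₂ m + (c + 3))^(c + 3)` — a
weakly-exponential size lower bound `m ≥ 2^(n^(1/(c+3)) - c - 3)`.  (This is the content the skeleton's
composition `MonotoneCoverHard_of` extracts; stated here on its own to make the calibration explicit.) -/
theorem weakExp_of_bet_of_rect
    (hbet : ∃ c n₀ : ℕ, ∀ (n m : ℕ) (E : Finset (Fin m × Fin m))
      (a : Fin m × Fin m → MvPolynomial (Fin n × Fin n) ℂ), n₀ ≤ n →
      (∃ s : Fin m × Fin m → ℂ, (∀ e, s e = 1 ∨ s e = -1) ∧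
        (Matrix.of fun i j => if (i, j) ∈ E then MvPolynomial.C (s (i, j)) * MvPolynomial.X (i, j)
            else 0 : Matrix (Fin m) (Fin m) (MvPolynomial (Fin m × Fin m) ℂ)).det =
          (Matrix.of fun i j => if (i, j) ∈ E then MvPolynomial.X (i, j) else 0 :
            Matrix (Fin m) (Fin m) (MvPolynomial (Fin m × Fin m) ℂ)).permanent) →
      (∀ e, (∃ j, a e = MvPolynomial.X j) ∨ a e = 0 ∨ a e = 1) →
      Literature.Computability.AlgebraicComplexity.perPoly (Fin n) ℂ =
        MvPolynomial.aeval a (Matrix.of fun i j => if (i, j) ∈ E then MvPolynomial.X (i, j) else 0 :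
            Matrix (Fin m) (Fin m) (MvPolynomial (Fin m × Fin m) ℂ)).permanent →
      ∃ S : Finset (Fin m ⊕ Fin m),
        (∀ τ : Equiv.Perm (Fin m), (∀ i, (i, τ i) ∈ E ∧ a (i, τ i) ≠ 0) →
          n ≤ 3 * (Finset.univ.filter fun i : Fin m =>
              Sum.inl i ∈ S ∧ Sum.inr (τ i) ∈ S ∧ ∃ j, a (i, τ i) = MvPolynomial.X j).card ∧
          3 * (Finset.univ.filter fun i : Fin m =>
              Sum.inl i ∈ S ∧ Sum.inr (τ i) ∈ S ∧ ∃ j, a (i, τ i) = MvPolynomial.X j).card ≤ 2 * n) ∧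
        ((Finset.univ.filter fun τ : Equiv.Perm (Fin m) => ∀ i, (i, τ i) ∈ E ∧ a (i, τ i) ≠ 0).image
            (fun τ : Equiv.Perm (Fin m) => (Finset.univ.filter fun i : Fin m =>
              (Sum.inl i ∈ S ∧ Sum.inr (τ i) ∉ S) ∨ (Sum.inl i ∉ S ∧ Sum.inr (τ i) ∈ S)).image
                fun i => (i, τ i))).card ≤ 2 ^ ((Nat.log 2 m + c) ^ c))
    (hrect : ∀ (n m : ℕ) (E : Finset (Fin m × Fin m))
      (a : Fin m × Fin m → MvPolynomial (Fin n × Fin n) ℂ),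
      (∃ s : Fin m × Fin m → ℂ, (∀ e, s e = 1 ∨ s e = -1) ∧
        (Matrix.of fun i j => if (i, j) ∈ E then MvPolynomial.C (s (i, j)) * MvPolynomial.X (i, j)
            else 0 : Matrix (Fin m) (Fin m) (MvPolynomial (Fin m × Fin m) ℂ)).det =
          (Matrix.of fun i j => if (i, j) ∈ E then MvPolynomial.X (i, j) else 0 :
            Matrix (Fin m) (Fin m) (MvPolynomial (Fin m × Fin m) ℂ)).permanent) →
      (∀ e, (∃ j, a e = MvPolynomial.X j) ∨ a e = 0 ∨ a e = 1) →
      Literature.Computability.AlgebraicComplexity.perPoly (Fin n) ℂ =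
        MvPolynomial.aeval a (Matrix.of fun i j => if (i, j) ∈ E then MvPolynomial.X (i, j) else 0 :
            Matrix (Fin m) (Fin m) (MvPolynomial (Fin m × Fin m) ℂ)).permanent →
      ∀ S : Finset (Fin m ⊕ Fin m),
        (∀ τ : Equiv.Perm (Fin m), (∀ i, (i, τ i) ∈ E ∧ a (i, τ i) ≠ 0) →
          n ≤ 3 * (Finset.univ.filter fun i : Fin m =>
              Sum.inl i ∈ S ∧ Sum.inr (τ i) ∈ S ∧ ∃ j, a (i, τ i) = MvPolynomial.X j).card ∧
          3 * (Finset.univ.filter fun i : Fin m =>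
              Sum.inl i ∈ S ∧ Sum.inr (τ i) ∈ S ∧ ∃ j, a (i, τ i) = MvPolynomial.X j).card ≤ 2 * n) →
        2 ^ (n / 3) ≤
          ((Finset.univ.filter fun τ : Equiv.Perm (Fin m) => ∀ i, (i, τ i) ∈ E ∧ a (i, τ i) ≠ 0).image
            (fun τ : Equiv.Perm (Fin m) => (Finset.univ.filter fun i : Fin m =>
              (Sum.inl i ∈ S ∧ Sum.inr (τ i) ∉ S) ∨ (Sum.inl i ∉ S ∧ Sum.inr (τ i) ∈ S)).image
                fun i => (i, τ i))).card) :
    ∃ d n₁ : ℕ, ∀ (n m : ℕ) (E : Finset (Fin m × Fin m))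
      (a : Fin m × Fin m → MvPolynomial (Fin n × Fin n) ℂ), n₁ ≤ n →
      (∃ s : Fin m × Fin m → ℂ, (∀ e, s e = 1 ∨ s e = -1) ∧
        (Matrix.of fun i j => if (i, j) ∈ E then MvPolynomial.C (s (i, j)) * MvPolynomial.X (i, j)
            else 0 : Matrix (Fin m) (Fin m) (MvPolynomial (Fin m × Fin m) ℂ)).det =
          (Matrix.of fun i j => if (i, j) ∈ E then MvPolynomial.X (i, j) else 0 :
            Matrix (Fin m) (Fin m) (MvPolynomial (Fin m × Fin m) ℂ)).permanent) →
      (∀ e, (∃ j, a e = MvPolynomial.X j) ∨ a e = 0 ∨ a e = 1) →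
      Literature.Computability.AlgebraicComplexity.perPoly (Fin n) ℂ =
        MvPolynomial.aeval a (Matrix.of fun i j => if (i, j) ∈ E then MvPolynomial.X (i, j) else 0 :
            Matrix (Fin m) (Fin m) (MvPolynomial (Fin m × Fin m) ℂ)).permanent →
      n ≤ (Nat.log 2 m + d) ^ d := by
  obtain ⟨c, n₀, hc⟩ := hbet
  refine ⟨c + 3, n₀, fun n m E a hn hsig ha hper => ?_⟩
  obtain ⟨S, hbal, hN⟩ := hc n m E a hn hsig ha hper
  have hlow := hrect n m E a hsig ha hper S hbal
  have h1 : n / 3 ≤ (Nat.log 2 m + c) ^ c :=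
    (Nat.pow_le_pow_iff_right Nat.one_lt_two).1 (hlow.trans hN)
  have h2 := three_mul_pow_add_two_le (Nat.log 2 m) c
  omega

/-- **`WEAKEXP ∧ BALEX ∧ COUNT ⇒ BET`.**  A weakly-exponential size lower bound for label-bijective
Pfaffian covers (`n ≤ (log₂ m + d)^d` for `n ≥ n₁`), the mere EXISTENCE of a balanced vertex set
(`n ≥ n₂`), and the count `#{weight-nonzero perfect matchings} ≤ n!` (label-injectivity) together give
the (repaired) bet `stub_fewStateCut` with `c = 2d + 1` and `n₀ = max n₁ n₂` — for ANY balanced `S`: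
`N(S) ≤ n! ≤ 2^(X·X)` with `X = (log₂ m + d)^d ≥ n`.  So the bet carries no information about cuts
beyond existence of a balanced one: its strength is that of the size lower bound. -/
theorem bet_of_weakExp_of_balEx_of_count
    (hweak : ∃ d n₁ : ℕ, ∀ (n m : ℕ) (E : Finset (Fin m × Fin m))
      (a : Fin m × Fin m → MvPolynomial (Fin n × Fin n) ℂ), n₁ ≤ n →
      (∃ s : Fin m × Fin m → ℂ, (∀ e, s e = 1 ∨ s e = -1) ∧
        (Matrix.of fun i j => if (i, j) ∈ E then MvPolynomial.C (s (i, j)) * MvPolynomial.X (i, j)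
            else 0 : Matrix (Fin m) (Fin m) (MvPolynomial (Fin m × Fin m) ℂ)).det =
          (Matrix.of fun i j => if (i, j) ∈ E then MvPolynomial.X (i, j) else 0 :
            Matrix (Fin m) (Fin m) (MvPolynomial (Fin m × Fin m) ℂ)).permanent) →
      (∀ e, (∃ j, a e = MvPolynomial.X j) ∨ a e = 0 ∨ a e = 1) →
      Literature.Computability.AlgebraicComplexity.perPoly (Fin n) ℂ =
        MvPolynomial.aeval a (Matrix.of fun i j => if (i, j) ∈ E then MvPolynomial.X (i, j) else 0 :
            Matrix (Fin m) (Fin m) (MvPolynomial (Fin m × Fin m) ℂ)).permanent →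
      n ≤ (Nat.log 2 m + d) ^ d)
    (hbalEx : ∃ n₂ : ℕ, ∀ (n m : ℕ) (E : Finset (Fin m × Fin m))
      (a : Fin m × Fin m → MvPolynomial (Fin n × Fin n) ℂ), n₂ ≤ n →
      (∃ s : Fin m × Fin m → ℂ, (∀ e, s e = 1 ∨ s e = -1) ∧
        (Matrix.of fun i j => if (i, j) ∈ E then MvPolynomial.C (s (i, j)) * MvPolynomial.X (i, j)
            else 0 : Matrix (Fin m) (Fin m) (MvPolynomial (Fin m × Fin m) ℂ)).det =
          (Matrix.of fun i j => if (i, j) ∈ E then MvPolynomial.X (i, j) else 0 :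
            Matrix (Fin m) (Fin m) (MvPolynomial (Fin m × Fin m) ℂ)).permanent) →
      (∀ e, (∃ j, a e = MvPolynomial.X j) ∨ a e = 0 ∨ a e = 1) →
      Literature.Computability.AlgebraicComplexity.perPoly (Fin n) ℂ =
        MvPolynomial.aeval a (Matrix.of fun i j => if (i, j) ∈ E then MvPolynomial.X (i, j) else 0 :
            Matrix (Fin m) (Fin m) (MvPolynomial (Fin m × Fin m) ℂ)).permanent →
      ∃ S : Finset (Fin m ⊕ Fin m),
        ∀ τ : Equiv.Perm (Fin m), (∀ i, (i, τ i) ∈ E ∧ a (i, τ i) ≠ 0) →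
          n ≤ 3 * (Finset.univ.filter fun i : Fin m =>
              Sum.inl i ∈ S ∧ Sum.inr (τ i) ∈ S ∧ ∃ j, a (i, τ i) = MvPolynomial.X j).card ∧
          3 * (Finset.univ.filter fun i : Fin m =>
              Sum.inl i ∈ S ∧ Sum.inr (τ i) ∈ S ∧ ∃ j, a (i, τ i) = MvPolynomial.X j).card ≤ 2 * n)
    (hcount : ∀ (n m : ℕ) (E : Finset (Fin m × Fin m))
      (a : Fin m × Fin m → MvPolynomial (Fin n × Fin n) ℂ),
      (∀ e, (∃ j, a e = MvPolynomial.X j) ∨ a e = 0 ∨ a e = 1) →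
      Literature.Computability.AlgebraicComplexity.perPoly (Fin n) ℂ =
        MvPolynomial.aeval a (Matrix.of fun i j => if (i, j) ∈ E then MvPolynomial.X (i, j) else 0 :
            Matrix (Fin m) (Fin m) (MvPolynomial (Fin m × Fin m) ℂ)).permanent →
      (Finset.univ.filter fun τ : Equiv.Perm (Fin m) => ∀ i, (i, τ i) ∈ E ∧ a (i, τ i) ≠ 0).card ≤
        n.factorial) :
    ∃ c n₀ : ℕ, ∀ (n m : ℕ) (E : Finset (Fin m × Fin m))
      (a : Fin m × Fin m → MvPolynomial (Fin n × Fin n) ℂ), n₀ ≤ n →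
      (∃ s : Fin m × Fin m → ℂ, (∀ e, s e = 1 ∨ s e = -1) ∧
        (Matrix.of fun i j => if (i, j) ∈ E then MvPolynomial.C (s (i, j)) * MvPolynomial.X (i, j)
            else 0 : Matrix (Fin m) (Fin m) (MvPolynomial (Fin m × Fin m) ℂ)).det =
          (Matrix.of fun i j => if (i, j) ∈ E then MvPolynomial.X (i, j) else 0 :
            Matrix (Fin m) (Fin m) (MvPolynomial (Fin m × Fin m) ℂ)).permanent) →
      (∀ e, (∃ j, a e = MvPolynomial.X j) ∨ a e = 0 ∨ a e = 1) →
      Literature.Computability.AlgebraicComplexity.perPoly (Fin n) ℂ =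
        MvPolynomial.aeval a (Matrix.of fun i j => if (i, j) ∈ E then MvPolynomial.X (i, j) else 0 :
            Matrix (Fin m) (Fin m) (MvPolynomial (Fin m × Fin m) ℂ)).permanent →
      ∃ S : Finset (Fin m ⊕ Fin m),
        (∀ τ : Equiv.Perm (Fin m), (∀ i, (i, τ i) ∈ E ∧ a (i, τ i) ≠ 0) →
          n ≤ 3 * (Finset.univ.filter fun i : Fin m =>
              Sum.inl i ∈ S ∧ Sum.inr (τ i) ∈ S ∧ ∃ j, a (i, τ i) = MvPolynomial.X j).card ∧
          3 * (Finset.univ.filter fun i : Fin m =>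
              Sum.inl i ∈ S ∧ Sum.inr (τ i) ∈ S ∧ ∃ j, a (i, τ i) = MvPolynomial.X j).card ≤ 2 * n) ∧
        ((Finset.univ.filter fun τ : Equiv.Perm (Fin m) => ∀ i, (i, τ i) ∈ E ∧ a (i, τ i) ≠ 0).image
            (fun τ : Equiv.Perm (Fin m) => (Finset.univ.filter fun i : Fin m =>
              (Sum.inl i ∈ S ∧ Sum.inr (τ i) ∉ S) ∨ (Sum.inl i ∉ S ∧ Sum.inr (τ i) ∈ S)).image
                fun i => (i, τ i))).card ≤ 2 ^ ((Nat.log 2 m + c) ^ c) := by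
  obtain ⟨d, n₁, hw⟩ := hweak
  obtain ⟨n₂, hb⟩ := hbalEx
  refine ⟨2 * d + 1, max n₁ n₂, fun n m E a hn hsig ha hper => ?_⟩
  obtain ⟨S, hbal⟩ := hb n m E a (le_trans (le_max_right _ _) hn) hsig ha hper
  refine ⟨S, hbal, ?_⟩
  have hX := hw n m E a (le_trans (le_max_left _ _) hn) hsig ha hper
  calc _ ≤ (Finset.univ.filter fun τ : Equiv.Perm (Fin m) =>
          ∀ i, (i, τ i) ∈ E ∧ a (i, τ i) ≠ 0).card := Finset.card_image_le
    _ ≤ n.factorial := hcount n m E a ha hper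
    _ ≤ 2 ^ ((Nat.log 2 m + d) ^ d * (Nat.log 2 m + d) ^ d) := factorial_le_two_pow_mul_self hX
    _ ≤ 2 ^ ((Nat.log 2 m + (2 * d + 1)) ^ (2 * d + 1)) :=
        Nat.pow_le_pow_right Nat.two_pos (pow_mul_pow_le _ _)

end Summit.ValiantsHypothesis.ValiantsHypothesis.Theorems.PolyaContinuedMonotoneCoverHard
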